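import Summits.QuantumFields.YangMills.Theorems.IR.Negative.TypShellCondFalseFixedMesh

/-!
# Crux `IR` (stmt-QuantumFields-19354) — the fixed-mesh negative for format T and the onset floor FOR EVERY COMPACT
# GAUGE GROUP, part 1/8: §A uniform Laplace upper bound on a compact space (section `UniformLaplace`)

Re-homed VERBATIM (statements, proofs, names; namespace `…Cruxes.IR.CruxIdea2g6` ↦ `…Cruxes.IR.FixedMeshAllG`) from the crux
workfile `Cruxes/IR/CruxIdea2FrameRowAllG.lean` rev 2 (sha16 81bea4c546c46a61; author `ym-cruxidea-19354-2` GEN 6) per owner R88,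
split by its sections into eight ≤ 400-line modules chained by import; credit docstring of record in the headline module
`Theorems/IR/Negative/TypShellCondFalseAllG.lean` (part 8/8).  Negative knowledge for stmt-QuantumFields-19354; closes no stub.
-/

set_option autoImplicit false

noncomputable section

open MeasureTheory Filter Topology
open Literature.MathematicalPhysics.QuantumLattice
open Literature.Probability.LatticeModels
open Summit.QuantumFields.YangMills.Cruxes.IR.Tempered (cellEdges windowCells regionEdges)
open Summit.QuantumFields.YangMills.Cruxes.IR.ShellTempered (windowCellsPlus)
open Summit.QuantumFields.YangMills.Cruxes.IR.OnsetFormats (TypShellCond shellCount)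
open Summit.QuantumFields.YangMills.Cruxes.IR.FixedMesh

namespace Summit.QuantumFields.YangMills.Cruxes.IR.FixedMeshAllG

section UniformLaplace

variable {X Y : Type*} [TopologicalSpace X] [CompactSpace X] [MeasurableSpace X] [OpensMeasurableSpace X]
  [TopologicalSpace Y] [CompactSpace Y] [FirstCountableTopology Y]

/-- **Uniform Laplace upper bound (abstract; PROVED).**  `X` compact with a finite open-positive reference
measure `μ`, `Y` a compact (first countable) parameter space, `S, g : Y × X → ℝ` continuous, `K ⊆ Y` closed.
If at every parameter `y ∈ K` the observable `g (y, ·)` is `≤ r` at every MINIMISER of `S (y, ·)`, then for every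
`s > 0` there are an open `O ⊇ K` and `β₀` such that the Gibbs averages satisfy
`∫ g e^{-β S} dμ ≤ (r + s) ∫ e^{-β S} dμ` for all `β ≥ β₀` and all `y ∈ O` (uniformly on a neighbourhood of `K`).
Proof: continuity of `m(y) = inf S(y,·)` (compactness), the defect `D = S - m ≥ 0`; on `K` the sub-level set
`{g ≥ r + s/2}` is compact and misses `{D = 0}`, so `D ≥ 2ε₁` there; the closed set `{D ≤ ε₁ ∧ g ≥ r + s/2}` has
closed projection (compact fibre) missing `K` — its complement is `O`; a uniform lower bound
`∫ e^{-βD} ≥ c e^{-βε₁/2}` comes from the continuous positive function `y ↦ ∫ ψ(D(y,x)) dμ` (`ψ` a cutoff at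
`ε₁/2`, Haar-type open positivity); the tail `{D > ε₁}` is then `O(e^{-βε₁/2})` relative to the mass. -/
theorem laplace_upper_uniform (μ : Measure X) [IsFiniteMeasure μ] [μ.IsOpenPosMeasure]
    {S g : Y × X → ℝ} (hS : Continuous S) (hg : Continuous g) {K : Set Y} (hK : IsClosed K) {r : ℝ}
    (hmin : ∀ y ∈ K, ∀ x, (∀ x', S (y, x) ≤ S (y, x')) → g (y, x) ≤ r) {s : ℝ} (hs : 0 < s) :
    ∃ O : Set Y, IsOpen O ∧ K ⊆ O ∧ ∃ β₀ : ℝ, ∀ β : ℝ, β₀ ≤ β → ∀ y ∈ O,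
      ∫ x, g (y, x) * Real.exp (-β * S (y, x)) ∂μ ≤ (r + s) * ∫ x, Real.exp (-β * S (y, x)) ∂μ := by
  classical
  rcases isEmpty_or_nonempty X with hX | hX
  · -- no points: all integrals vanish
    refine ⟨Set.univ, isOpen_univ, Set.subset_univ _, 0, fun β _ y _ => ?_⟩
    have h0 : μ = 0 := Measure.eq_zero_of_isEmpty μ
    simp [h0]
  -- the minimal energy `m` and the defect `D`
  set m : Y → ℝ := fun y => sInf ((fun x => S (y, x)) '' Set.univ) with hm
  have hmc : Continuous m :=
    isCompact_univ.continuous_sInf (f := fun (y : Y) (x : X) => S (y, x))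
      (show Continuous (↿fun (y : Y) (x : X) => S (y, x)) from hS.comp (continuous_fst.prodMk continuous_snd))
  have hbdd : ∀ y, BddBelow ((fun x => S (y, x)) '' Set.univ) := fun y =>
    (isCompact_univ.image (hS.comp (Continuous.prodMk_right y))).bddBelow
  have hm_le : ∀ y x, m y ≤ S (y, x) := fun y x => csInf_le (hbdd y) ⟨x, Set.mem_univ x, rfl⟩
  have hm_att : ∀ y, ∃ x, S (y, x) = m y := fun y => by
    obtain ⟨x, -, hx⟩ := isCompact_univ.exists_sInf_image_eq Set.univ_nonempty
      (hS.comp (Continuous.prodMk_right y)).continuousOn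
    exact ⟨x, hx.symm⟩
  set D : Y × X → ℝ := fun p => S p - m p.1 with hD
  have hDc : Continuous D := hS.sub (hmc.comp continuous_fst)
  have hD0 : ∀ p, 0 ≤ D p := fun p => by
    have := hm_le p.1 p.2
    simp only [hD]; linarith
  have hDmin : ∀ y x, D (y, x) = 0 → ∀ x', S (y, x) ≤ S (y, x') := fun y x h x' => by
    have h1 : S (y, x) = m y := by simp only [hD] at h; linarith
    rw [h1]; exact hm_le y x'
  -- Step 1: on `K`, `g ≥ r + s/2` forces a defect `≥ 2ε₁`
  obtain ⟨ε₁, hε₁, hsep⟩ : ∃ ε₁ : ℝ, 0 < ε₁ ∧ ∀ p : Y × X, p.1 ∈ K → r + s / 2 ≤ g p → 2 * ε₁ ≤ D p := by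
    set C : Set (Y × X) := {p | p.1 ∈ K ∧ r + s / 2 ≤ g p} with hC
    have hCc : IsCompact C :=
      ((hK.preimage continuous_fst).inter (isClosed_le continuous_const hg)).isCompact
    by_cases hne : C.Nonempty
    · obtain ⟨p₀, hp₀, hle⟩ := hCc.exists_isMinOn hne hDc.continuousOn
      have hpos : 0 < D p₀ := by
        rcases (hD0 p₀).lt_or_eq with h | h
        · exact h
        · exfalso
          have hg0 : g (p₀.1, p₀.2) ≤ r := hmin p₀.1 hp₀.1 p₀.2 (hDmin p₀.1 p₀.2 h.symm)
          have : r + s / 2 ≤ g p₀ := hp₀.2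
          simp only [Prod.mk.eta] at hg0
          linarith
      refine ⟨D p₀ / 2, by positivity, fun p hpK hpg => ?_⟩
      have := hle (show p ∈ C from ⟨hpK, hpg⟩)
      rw [Set.mem_setOf_eq] at this
      linarith
    · exact ⟨1, one_pos, fun p hpK hpg => (hne ⟨p, hpK, hpg⟩).elim⟩
  -- Step 2: the open neighbourhood `O` of `K`
  set Bad : Set (Y × X) := {p | D p ≤ ε₁ ∧ r + s / 2 ≤ g p} with hBad
  have hBadc : IsClosed Bad := (isClosed_le hDc continuous_const).inter (isClosed_le continuous_const hg)
  set O : Set Y := (Prod.fst '' Bad)ᶜ with hO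
  have hOo : IsOpen O := (isClosedMap_fst_of_compactSpace _ hBadc).isOpen_compl
  have hKO : K ⊆ O := by
    rintro y hy ⟨p, hp, rfl⟩
    have h2 := hsep p hy hp.2
    have h1 := hp.1
    linarith
  have hgood : ∀ y ∈ O, ∀ x, D (y, x) ≤ ε₁ → g (y, x) < r + s / 2 := fun y hy x hDx => by
    by_contra h
    exact hy ⟨(y, x), ⟨hDx, not_lt.1 h⟩, rfl⟩
  -- Step 3: a uniform lower bound for the defect partition function
  set ψ : ℝ → ℝ := fun t => max 0 (1 - 2 * t / ε₁) with hψ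
  have hψc : Continuous ψ := continuous_const.max (continuous_const.sub (continuous_const.mul continuous_id
    |>.div_const _))
  have hψ0 : ∀ t, 0 ≤ ψ t := fun t => le_max_left _ _
  have hψ1 : ∀ t, 0 ≤ t → ψ t ≤ 1 := fun t ht => max_le zero_le_one (by
    have : 0 ≤ 2 * t / ε₁ := by positivity
    linarith)
  have hψvan : ∀ t, ε₁ / 2 ≤ t → ψ t = 0 := fun t ht => by
    refine max_eq_left ?_
    rw [sub_nonpos, le_div_iff₀ hε₁]; linarith
  set Φ : Y → ℝ := fun y => ∫ x, ψ (D (y, x)) ∂μ with hΦ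
  have hΦc : Continuous Φ :=
    continuous_integral_of_bound (fun y => hψc.comp (hDc.comp (Continuous.prodMk_right y)))
      (fun x => hψc.comp (hDc.comp (Continuous.prodMk_left x))) (C := 1) fun y x => by
        rw [abs_of_nonneg (hψ0 _)]; exact hψ1 _ (hD0 _)
  have hΦpos : ∀ y, 0 < Φ y := fun y => by
    obtain ⟨x₀, hx₀⟩ := hm_att y
    have hD00 : D (y, x₀) = 0 := by simp only [hD, hx₀, sub_self]
    refine (hψc.comp (hDc.comp (Continuous.prodMk_right y))).integral_pos_of_hasCompactSupport_nonneg_nonzero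
      (HasCompactSupport.of_compactSpace _) (fun x => hψ0 _) (x := x₀) ?_
    simp only [hD00, hψ, mul_zero, zero_div, sub_zero]
    norm_num
  obtain ⟨c, hc, hcΦ⟩ : ∃ c : ℝ, 0 < c ∧ ∀ y, c ≤ Φ y := by
    rcases isEmpty_or_nonempty Y with hY | hY
    · exact ⟨1, one_pos, fun y => (IsEmpty.false y).elim⟩
    · obtain ⟨y₀, -, hy₀⟩ := isCompact_univ.exists_isMinOn Set.univ_nonempty hΦc.continuousOn
      exact ⟨Φ y₀, hΦpos y₀, fun y => hy₀ (Set.mem_univ y)⟩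
  have hint : ∀ {f : Y × X → ℝ}, Continuous f → ∀ y, Integrable (fun x => f (y, x)) μ := fun hf y =>
    Summit.QuantumFields.YangMills.Theorems.TunedSequenceExists.Negative.Freezing.integrable_of_continuous μ
      (hf.comp (Continuous.prodMk_right y))
  have hZ_ge : ∀ y, ∀ β : ℝ, 0 ≤ β →
      c * Real.exp (-β * (ε₁ / 2)) ≤ ∫ x, Real.exp (-β * D (y, x)) ∂μ := fun y β hβ => by
    have hpt : ∀ x, ψ (D (y, x)) * Real.exp (-β * (ε₁ / 2)) ≤ Real.exp (-β * D (y, x)) := fun x => by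
      by_cases hx : ε₁ / 2 ≤ D (y, x)
      · rw [hψvan _ hx, zero_mul]; exact (Real.exp_pos _).le
      · calc ψ (D (y, x)) * Real.exp (-β * (ε₁ / 2)) ≤ 1 * Real.exp (-β * (ε₁ / 2)) :=
              mul_le_mul_of_nonneg_right (hψ1 _ (hD0 _)) (Real.exp_pos _).le
          _ ≤ Real.exp (-β * D (y, x)) := by
              rw [one_mul]; exact Real.exp_le_exp.2 (by nlinarith [not_le.1 hx])
    calc c * Real.exp (-β * (ε₁ / 2)) ≤ Φ y * Real.exp (-β * (ε₁ / 2)) :=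
          mul_le_mul_of_nonneg_right (hcΦ y) (Real.exp_pos _).le
      _ = ∫ x, ψ (D (y, x)) * Real.exp (-β * (ε₁ / 2)) ∂μ := (integral_mul_const _ _).symm
      _ ≤ ∫ x, Real.exp (-β * D (y, x)) ∂μ :=
          integral_mono ((hint (hψc.comp hDc) y).mul_const _)
            (hint (Real.continuous_exp.comp (continuous_const.mul hDc)) y) hpt
  -- Step 4: the tail rate and `β₀`
  obtain ⟨M, hM⟩ := exists_bound_of_continuous hg
  set C₁ : ℝ := |M| + |r + s / 2| with hC₁
  have hC₁0 : 0 ≤ C₁ := by positivity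
  have hgC : ∀ p, |g p - (r + s / 2)| ≤ C₁ := fun p =>
    (abs_sub _ _).trans (add_le_add ((hM p).trans (le_abs_self M)) le_rfl)
  set U : ℝ := μ.real Set.univ with hU
  have hU0 : 0 ≤ U := measureReal_nonneg
  set q : ℝ := s * c / (2 * (C₁ * U + 1)) with hq
  have hq0 : 0 < q := by positivity
  have hqkey : C₁ * U * q ≤ s / 2 * c := by
    rw [hq]
    have h1 : 0 < C₁ * U + 1 := by positivity
    rw [show C₁ * U * (s * c / (2 * (C₁ * U + 1))) = (s / 2 * c) * (C₁ * U / (C₁ * U + 1)) by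
      field_simp]
    refine mul_le_of_le_one_right (by positivity) ((div_le_one h1).2 (by linarith))
  have hlim : Tendsto (fun β : ℝ => Real.exp (-β * (ε₁ / 2))) atTop (𝓝 0) := by
    have h0 : Tendsto (fun β : ℝ => β * (ε₁ / 2)) atTop atTop := tendsto_id.atTop_mul_const (half_pos hε₁)
    refine (Real.tendsto_exp_atBot.comp (tendsto_neg_atTop_atBot.comp h0)).congr fun β => ?_
    simp only [Function.comp_apply, neg_mul]
  obtain ⟨β₁, hβ₁⟩ := eventually_atTop.1 (hlim.eventually (gt_mem_nhds hq0))
  refine ⟨O, hOo, hKO, max β₁ 0, fun β hβ y hy => ?_⟩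
  have hβ0 : 0 ≤ β := le_trans (le_max_right _ _) hβ
  have hβ1 : β₁ ≤ β := le_trans (le_max_left _ _) hβ
  have hexpq : Real.exp (-β * (ε₁ / 2)) ≤ q := (hβ₁ β hβ1).le
  -- reduce to the defect weights: `e^{-βS} = e^{-β m} e^{-βD}`
  have hfac : ∀ x, Real.exp (-β * S (y, x)) = Real.exp (-β * m y) * Real.exp (-β * D (y, x)) := fun x => by
    rw [← Real.exp_add]; congr 1; simp only [hD]; ring
  have hL : ∫ x, g (y, x) * Real.exp (-β * S (y, x)) ∂μ =
      Real.exp (-β * m y) * ∫ x, g (y, x) * Real.exp (-β * D (y, x)) ∂μ := by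
    rw [← integral_const_mul]
    refine integral_congr_ae (ae_of_all _ fun x => ?_)
    simp only [hfac x]; ring
  have hR : ∫ x, Real.exp (-β * S (y, x)) ∂μ = Real.exp (-β * m y) * ∫ x, Real.exp (-β * D (y, x)) ∂μ := by
    rw [← integral_const_mul]
    exact integral_congr_ae (ae_of_all _ fun x => hfac x)
  rw [hL, hR, ← mul_assoc, mul_comm (r + s), mul_assoc]
  refine mul_le_mul_of_nonneg_left ?_ (Real.exp_pos _).le
  -- pointwise bound with the tail constant
  set w : X → ℝ := fun x => Real.exp (-β * D (y, x)) with hw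
  have hw_pos : ∀ x, 0 < w x := fun x => Real.exp_pos _
  have hpt : ∀ x, g (y, x) * w x ≤ (r + s / 2) * w x + C₁ * Real.exp (-β * ε₁) := fun x => by
    by_cases hx : D (y, x) ≤ ε₁
    · have h1 : g (y, x) * w x ≤ (r + s / 2) * w x :=
        mul_le_mul_of_nonneg_right (hgood y hy x hx).le (hw_pos x).le
      have h2 : 0 ≤ C₁ * Real.exp (-β * ε₁) := mul_nonneg hC₁0 (Real.exp_pos _).le
      linarith
    · have hwx : w x ≤ Real.exp (-β * ε₁) := Real.exp_le_exp.2 (by nlinarith [not_le.1 hx])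
      have h1 : (g (y, x) - (r + s / 2)) * w x ≤ C₁ * Real.exp (-β * ε₁) :=
        (le_abs_self _).trans (by
          rw [abs_mul, abs_of_pos (hw_pos x)]
          exact mul_le_mul (hgC _) hwx (hw_pos x).le hC₁0)
      linarith
  have hwc : Continuous fun p : Y × X => Real.exp (-β * D p) := Real.continuous_exp.comp (continuous_const.mul hDc)
  have hint_w : Integrable w μ := hint hwc y
  have hint_gw : Integrable (fun x => g (y, x) * w x) μ := hint (hg.mul hwc) y
  have hI : ∫ x, g (y, x) * w x ∂μ ≤ (r + s / 2) * (∫ x, w x ∂μ) + C₁ * Real.exp (-β * ε₁) * U := by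
    calc ∫ x, g (y, x) * w x ∂μ ≤ ∫ x, ((r + s / 2) * w x + C₁ * Real.exp (-β * ε₁)) ∂μ :=
          integral_mono hint_gw ((hint_w.const_mul _).add (integrable_const _)) hpt
      _ = (r + s / 2) * (∫ x, w x ∂μ) + C₁ * Real.exp (-β * ε₁) * U := by
          rw [integral_add (hint_w.const_mul _) (integrable_const _), integral_const_mul, integral_const,
            smul_eq_mul, hU]
          ring
  -- the tail is at most `(s/2) Z`
  have hZ := hZ_ge y β hβ0
  have htail : C₁ * Real.exp (-β * ε₁) * U ≤ s / 2 * ∫ x, w x ∂μ := by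
    have hsplit : Real.exp (-β * ε₁) = Real.exp (-β * (ε₁ / 2)) * Real.exp (-β * (ε₁ / 2)) := by
      rw [← Real.exp_add]; ring_nf
    calc C₁ * Real.exp (-β * ε₁) * U
        = (C₁ * U) * Real.exp (-β * (ε₁ / 2)) * Real.exp (-β * (ε₁ / 2)) := by rw [hsplit]; ring
      _ ≤ (C₁ * U) * q * Real.exp (-β * (ε₁ / 2)) := by
          refine mul_le_mul_of_nonneg_right ?_ (Real.exp_pos _).le
          exact mul_le_mul_of_nonneg_left hexpq (mul_nonneg hC₁0 hU0)
      _ ≤ (s / 2 * c) * Real.exp (-β * (ε₁ / 2)) := mul_le_mul_of_nonneg_right hqkey (Real.exp_pos _).le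
      _ = s / 2 * (c * Real.exp (-β * (ε₁ / 2))) := by ring
      _ ≤ s / 2 * ∫ x, w x ∂μ := mul_le_mul_of_nonneg_left hZ (by positivity)
  have : (r + s / 2) * (∫ x, w x ∂μ) + s / 2 * (∫ x, w x ∂μ) = (r + s) * ∫ x, w x ∂μ := by ring
  linarith

end UniformLaplace

end Summit.QuantumFields.YangMills.Cruxes.IR.FixedMeshAllG

end
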